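import Summits.CriticalPhenomena.PercolationContinuityZ3.Theorems.PercNearOneGluingNoHeavyLowerTailMajorityGluingQCert
import Summits.CriticalPhenomena.PercolationContinuityZ3.Theorems.PercNearOneGluingNoHeavyLowerTailMajorityGluingSix
import HarnessLib

/-!
# The percolation dictionary of the six-relay certificate language: cut codes, the cut-pattern law, and the events of the forms (lane prim-rate, constants-miner 1, gen 34; CANDIDATES §GEN-33 R324, NEXT-g34 item 1)

Support file for the closed crux `NoHeavyLowerTail` (stmt-CriticalPhenomena-4575), majority-gluing line; the dictionary between the
certificate language of `…MajorityGluingQCert` at `m = 6` relays and bond percolation, consumed by `…MajorityGluingEightCert`.  For a hub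
`a₀`, an enumeration `t : Fin 6 → Fin n` of six relays and a configuration `ω`, `enc ω < 64` is the bitmask of the cut relays
(`code`, `testBit_enc`); the point `lawv` of the language is `K ↦ μ(enc = K)` (`K < 64`), `64 ↦ δ`.  Every `0/1`-form vanishing at the
variable `64` evaluates to the probability of its event (`linv_lawv`, by the partition `real_setOf_enc`), and the events are identified:
marginals `{t x ↮ a₀}` (`setOf_margMem`), threshold `{4 ≤ #cut T}` (`setOf_tMem`; `popc_enc`: the popcount of the code is the number of
cut relays), case forms of family `1` `{t x ↔ a₀} ∩ {4 ≤ #cut T}` (`setOf_eMem`), and a mask agreeing with the cylinder `(A, X)`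
(`Cert.maskOK`) gives `{im A attached} ∩ {im X cut}` (`setOf_cyl`, via `cylMem_iff`; `im` = image of a bitmask of relay indices, with
`im_or`, `im_and`, `im_zero` for the van den Berg–Kahn row shapes).  No sorries. [folklore]
-/

noncomputable section

namespace Summit.CriticalPhenomena.PercolationContinuityZ3.Theorems

open MeasureTheory Set
open Literature.Probability.LatticeModels (prodBernoulli)
open Literature.Probability.Percolation
open scoped Classical

namespace HubOnly
namespace QCert

/-! ### Binary codes -/

/-- The binary code of the first `m` values of `b`: `Σ_{i<m} [b i]·2^i`. -/
def code : ℕ → (ℕ → Bool) → ℕ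
  | 0, _ => 0
  | m + 1, b => cond (b 0) 1 0 + 2 * code m (fun i => b (i + 1))

/-- `code m b < 2^m`. -/
theorem code_lt : ∀ (m : ℕ) (b : ℕ → Bool), code m b < 2 ^ m
  | 0, _ => by simp [code]
  | m + 1, b => by
    have ih := code_lt m (fun i => b (i + 1))
    rw [code, pow_succ]
    cases b 0
    · rw [cond_false]; omega
    · rw [cond_true]; omega

/-- The bits of `code m b` are the `b i`, `i < m`. -/
theorem testBit_code : ∀ (m : ℕ) (b : ℕ → Bool) (i : ℕ), (code m b).testBit i = (decide (i < m) && b i)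
  | 0, _, i => by simp [code]
  | m + 1, b, 0 => by
    rw [code, Nat.testBit_zero]
    cases b 0
    · rw [cond_false, zero_add, Nat.mul_mod_right]; simp
    · rw [cond_true, Nat.add_mul_mod_self_left]; simp
  | m + 1, b, i + 1 => by
    have hdiv : (cond (b 0) 1 0 + 2 * code m (fun j => b (j + 1))) / 2 = code m (fun j => b (j + 1)) := by
      cases b 0
      · rw [cond_false]; omega
      · rw [cond_true]; omega
    rw [code, Nat.testBit_succ, hdiv, testBit_code m (fun j => b (j + 1)) i]
    by_cases h : i < m <;> simp [h]

/-- **The cylinder test, set-theoretically:** for `A, X, K < 2^m`, `cylMem m A X K` says that every bit of `X` is set in `K` and no bit of `A` is. -/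
theorem cylMem_iff (m A X K : ℕ) (hK : K < 2 ^ m) :
    cylMem m A X K = true ↔ (∀ i, X.testBit i = true → K.testBit i = true) ∧ (∀ i, A.testBit i = true → K.testBit i = false) := by
  unfold cylMem
  simp only [Bool.and_eq_true, Nat.blt_eq, Nat.beq_eq]
  constructor
  · rintro ⟨⟨_, hX⟩, hA⟩
    have hX' : K &&& X = X := hX
    have hA' : K &&& A = 0 := hA
    refine ⟨fun i hi => ?_, fun i hi => ?_⟩
    · have h := congrArg (fun z => Nat.testBit z i) hX'
      simp only [Nat.testBit_land, hi, Bool.and_true] at h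
      exact h
    · have h := congrArg (fun z => Nat.testBit z i) hA'
      simp only [Nat.testBit_land, hi, Bool.and_true, Nat.zero_testBit] at h
      exact h
  · rintro ⟨hX, hA⟩
    refine ⟨⟨hK, ?_⟩, ?_⟩
    · change K &&& X = X
      refine Nat.eq_of_testBit_eq fun i => ?_
      rw [Nat.testBit_land]
      cases h : X.testBit i
      · simp
      · simp [hX i h]
    · change K &&& A = 0
      refine Nat.eq_of_testBit_eq fun i => ?_
      rw [Nat.testBit_land, Nat.zero_testBit]
      cases h : A.testBit i
      · simp
      · simp [hA i h]

/-- `popc m K` is the number of `x < m` with bit `x` set. -/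
theorem popc_eq_card (m K : ℕ) : popc m K = ((Finset.range m).filter fun x => K.testBit x = true).card := by
  unfold popc
  simp only [tb_eq]
  rw [Finset.card_def, Finset.filter_val, Finset.range_val, Multiset.range, Multiset.filter_coe, Multiset.coe_card]
  congr 1
  exact List.filter_congr fun x _ => by simp

/-! ### The cut code of a configuration -/

variable {n : ℕ}

/-- The cut vector of `ω` along the enumeration `t` (extended by `false`). -/
def cutFn (a₀ : Fin n) (t : Fin 6 → Fin n) (ω : BondConfig (Fin n)) (i : ℕ) : Bool :=
  if h : i < 6 then decide (ω ∉ (openConn a₀ (t ⟨i, h⟩) : Set (BondConfig (Fin n)))) else false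

/-- The cut code: bit `x` = «`t x` is cut from `a₀`». -/
def enc (a₀ : Fin n) (t : Fin 6 → Fin n) (ω : BondConfig (Fin n)) : ℕ := code 6 (cutFn a₀ t ω)

/-- The cut code is `< 64`. -/
theorem enc_lt (a₀ : Fin n) (t : Fin 6 → Fin n) (ω : BondConfig (Fin n)) : enc a₀ t ω < 64 := code_lt 6 _

/-- Bit `x` of the cut code is «`t x` is cut from `a₀`». -/
theorem testBit_enc (a₀ : Fin n) (t : Fin 6 → Fin n) (ω : BondConfig (Fin n)) (x : Fin 6) :
    (enc a₀ t ω).testBit x = decide (ω ∉ (openConn a₀ (t x) : Set (BondConfig (Fin n)))) := by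
  rw [enc, testBit_code]; simp [cutFn, x.isLt]

/-- Bit `i < 6` of the cut code is «`t i` is cut from `a₀`». -/
theorem testBit_enc_of_lt (a₀ : Fin n) (t : Fin 6 → Fin n) (ω : BondConfig (Fin n)) (i : ℕ) (hi : i < 6) :
    (enc a₀ t ω).testBit i = decide (ω ∉ (openConn a₀ (t ⟨i, hi⟩) : Set (BondConfig (Fin n)))) :=
  testBit_enc a₀ t ω ⟨i, hi⟩

/-- The cut code has no bits `≥ 6`. -/
theorem testBit_enc_of_ge (a₀ : Fin n) (t : Fin 6 → Fin n) (ω : BondConfig (Fin n)) (i : ℕ) (hi : 6 ≤ i) :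
    (enc a₀ t ω).testBit i = false := by
  rw [enc, testBit_code]; simp; omega

/-- **Partition by the cut code:** `μ{P(enc ω)} = Σ_{K<64} [P K]·μ(enc = K)`. [folklore] -/
theorem real_setOf_enc (w : Sym2 (Fin n) → unitInterval) (a₀ : Fin n) (t : Fin 6 → Fin n) (P : ℕ → Bool) :
    (prodBernoulli w).real {ω : BondConfig (Fin n) | P (enc a₀ t ω) = true} =
      ∑ K ∈ Finset.range 64, if P K then (prodBernoulli w).real {ω : BondConfig (Fin n) | enc a₀ t ω = K} else 0 := by
  have hms : ∀ S' : Set (BondConfig (Fin n)), MeasurableSet S' := fun _ => MeasurableSet.of_discrete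
  set S : Set (BondConfig (Fin n)) := {ω | P (enc a₀ t ω) = true} with hS
  have h := sum_measureReal_preimage_singleton (μ := (prodBernoulli w).restrict S) (Finset.range 64) (f := enc a₀ t)
    (fun K _ => hms _)
  have hpre : (enc a₀ t) ⁻¹' (↑(Finset.range 64) : Set ℕ) = univ :=
    eq_univ_of_forall fun ω => by rw [mem_preimage, Finset.mem_coe, Finset.mem_range]; exact enc_lt a₀ t ω
  rw [hpre, measureReal_restrict_apply_univ] at h
  rw [← h]
  refine Finset.sum_congr rfl fun K _ => ?_
  rw [measureReal_restrict_apply (hms _)]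
  by_cases hP : P K = true
  · rw [if_pos hP]; congr 1; ext ω
    simp only [mem_inter_iff, mem_preimage, mem_singleton_iff, hS, mem_setOf_eq]
    exact ⟨fun h => h.1, fun h => ⟨h, by rw [h]; exact hP⟩⟩
  · rw [if_neg hP]
    have : (enc a₀ t) ⁻¹' {K} ∩ S = ∅ := by
      ext ω; simp only [mem_inter_iff, mem_preimage, mem_singleton_iff, hS, mem_setOf_eq, mem_empty_iff_false, iff_false, not_and]
      intro h; rw [h]; exact hP
    rw [this, measureReal_empty]

/-- The point of the certificate language: `K ↦ μ(enc = K)` for `K < 64`, `64 ↦ δ`, `0` beyond. -/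
def lawv (w : Sym2 (Fin n) → unitInterval) (a₀ : Fin n) (t : Fin 6 → Fin n) (δ : ℝ) (K : ℕ) : ℝ :=
  if K < 64 then (prodBernoulli w).real {ω : BondConfig (Fin n) | enc a₀ t ω = K} else if K = 64 then δ else 0

/-- The point `lawv` is nonnegative (for `δ ≥ 0`). -/
theorem lawv_nonneg (w : Sym2 (Fin n) → unitInterval) (a₀ : Fin n) (t : Fin 6 → Fin n) (δ : ℝ) (hδ : 0 ≤ δ) (K : ℕ) :
    0 ≤ lawv w a₀ t δ K := by
  unfold lawv; split_ifs
  · exact measureReal_nonneg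
  · exact hδ
  · exact le_rfl

/-- The variable `64` of `lawv` is `δ`. -/
theorem lawv_D (w : Sym2 (Fin n) → unitInterval) (a₀ : Fin n) (t : Fin 6 → Fin n) (δ : ℝ) : lawv w a₀ t δ 64 = δ := by
  simp [lawv]

/-- **Every `0/1`-form of the language is the probability of its event** (forms vanishing at the variable `64 = δ`). [folklore] -/
theorem linv_lawv (w : Sym2 (Fin n) → unitInterval) (a₀ : Fin n) (t : Fin 6 → Fin n) (δ : ℝ) (P : ℕ → Bool) (hP : P 64 = false) :
    linv 65 (fun i => Cert.bi (P i)) (lawv w a₀ t δ) = (prodBernoulli w).real {ω : BondConfig (Fin n) | P (enc a₀ t ω) = true} := by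
  rw [real_setOf_enc, linv, Finset.sum_range_succ, hP]
  simp only [Cert.bi, Bool.false_eq_true, ↓reduceIte, Int.cast_zero, zero_mul, add_zero]
  refine Finset.sum_congr rfl fun K hK => ?_
  rw [Finset.mem_range] at hK
  unfold lawv; rw [if_pos hK]
  cases P K <;> simp

/-! ### The events of the language -/

/-- The number of cut relays is the popcount of the code (for an injective enumeration of `T`). [folklore] -/
theorem popc_enc (a₀ : Fin n) (t : Fin 6 → Fin n) (ht : Function.Injective t) (T : Finset (Fin n))
    (hT : T = Finset.univ.image t) (ω : BondConfig (Fin n)) :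
    popc 6 (enc a₀ t ω) = (T.filter fun x => ω ∉ (openConn a₀ x : Set (BondConfig (Fin n)))).card := by
  rw [popc_eq_card, hT, Finset.filter_image, Finset.card_image_of_injective _ ht]
  -- both sides count `{i < 6 | t i cut}`
  rw [← Nat.Iio_eq_range, ← Fin.map_valEmbedding_univ, Finset.filter_map, Finset.card_map]
  congr 1
  ext x
  simp only [Finset.mem_filter, Finset.mem_univ, true_and, Function.comp_apply, Fin.valEmbedding_apply, testBit_enc,
    decide_eq_true_eq]

/-- The image of a bitmask of relay indices. -/
def im (t : Fin 6 → Fin n) (A : ℕ) : Set (Fin n) := {v | ∃ x : Fin 6, A.testBit x = true ∧ t x = v}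

/-- The image of a union of bitmasks. -/
theorem im_or (t : Fin 6 → Fin n) (A B : ℕ) : im t (A ||| B) = im t A ∪ im t B := by
  ext v
  simp only [im, mem_setOf_eq, mem_union, Nat.testBit_lor, Bool.or_eq_true]
  constructor
  · rintro ⟨x, h | h, rfl⟩
    · exact Or.inl ⟨x, h, rfl⟩
    · exact Or.inr ⟨x, h, rfl⟩
  · rintro (⟨x, h, rfl⟩ | ⟨x, h, rfl⟩)
    · exact ⟨x, Or.inl h, rfl⟩
    · exact ⟨x, Or.inr h, rfl⟩

/-- The image of an intersection of bitmasks (injective enumeration). -/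
theorem im_and (t : Fin 6 → Fin n) (ht : Function.Injective t) (X Y : ℕ) : im t (X &&& Y) = im t X ∩ im t Y := by
  ext v
  simp only [im, mem_setOf_eq, mem_inter_iff, Nat.testBit_land, Bool.and_eq_true]
  constructor
  · rintro ⟨x, ⟨h1, h2⟩, rfl⟩; exact ⟨⟨x, h1, rfl⟩, ⟨x, h2, rfl⟩⟩
  · rintro ⟨⟨x, h1, rfl⟩, ⟨y, h2, hy⟩⟩
    have hxy : y = x := ht hy
    subst hxy
    exact ⟨y, ⟨h1, h2⟩, rfl⟩

/-- The image of the empty bitmask. -/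
theorem im_zero (t : Fin 6 → Fin n) : im t 0 = ∅ := by
  ext v; simp [im]

section Dictionary

variable (c : Cert) (hm : c.m = 6) (hh : c.h = 4) (hfam : c.fam = 1)
include hm

/-- The marginal form of relay `x < 6` is «`t x` cut». -/
theorem setOf_margMem (a₀ : Fin n) (t : Fin 6 → Fin n) (x : Fin 6) :
    {ω : BondConfig (Fin n) | c.margMem x (enc a₀ t ω) = true} = (openConn a₀ (t x) : Set (BondConfig (Fin n)))ᶜ := by
  ext ω
  simp only [mem_setOf_eq, Cert.margMem, hm, Bool.and_eq_true, decide_eq_true_eq, tb_eq, testBit_enc, mem_compl_iff]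
  exact ⟨fun h => h.2, fun h => ⟨enc_lt a₀ t ω, h⟩⟩

include hh in
/-- The threshold form is «at least four of `T` cut». -/
theorem setOf_tMem (a₀ : Fin n) (t : Fin 6 → Fin n) (ht : Function.Injective t) (T : Finset (Fin n))
    (hT : T = Finset.univ.image t) :
    {ω : BondConfig (Fin n) | c.tMem (enc a₀ t ω) = true} =
      {ω : BondConfig (Fin n) | 4 ≤ (T.filter fun x => ω ∉ (openConn a₀ x : Set (BondConfig (Fin n)))).card} := by
  ext ω
  simp only [mem_setOf_eq, Cert.tMem, hm, hh, Bool.and_eq_true, decide_eq_true_eq, popc_enc a₀ t ht T hT]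
  exact ⟨fun h => h.2, fun h => ⟨enc_lt a₀ t ω, h⟩⟩

include hh hfam in
/-- The case form of relay `x < 6` (family `1`) is «`t x` attached and at least four of `T` cut». -/
theorem setOf_eMem (a₀ : Fin n) (t : Fin 6 → Fin n) (ht : Function.Injective t) (T : Finset (Fin n))
    (hT : T = Finset.univ.image t) (x : Fin 6) :
    {ω : BondConfig (Fin n) | c.eMem x (enc a₀ t ω) = true} =
      (openConn a₀ (t x) : Set (BondConfig (Fin n))) ∩
        {ω : BondConfig (Fin n) | 4 ≤ (T.filter fun x => ω ∉ (openConn a₀ x : Set (BondConfig (Fin n)))).card} := by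
  ext ω
  have he : c.eMem x (enc a₀ t ω) = (decide (enc a₀ t ω < 2 ^ 6) && decide (4 ≤ popc 6 (enc a₀ t ω)) && !tb (enc a₀ t ω) x) := by
    unfold Cert.eMem; rw [hfam, hm, hh]; rfl
  rw [mem_setOf_eq, mem_inter_iff, mem_setOf_eq, he, popc_enc a₀ t ht T hT, tb_eq, testBit_enc]
  simp only [Bool.and_eq_true, decide_eq_true_eq, Bool.not_eq_true', decide_eq_false_iff_not, not_not]
  constructor
  · rintro ⟨⟨_, h4⟩, hatt⟩; exact ⟨hatt, h4⟩
  · rintro ⟨hatt, h4⟩; exact ⟨⟨enc_lt a₀ t ω, h4⟩, hatt⟩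

/-- **A mask agreeing with the cylinder `(A, X)` evaluates to the cylinder event** «`im A` attached, `im X` cut». [folklore] -/
theorem setOf_cyl (a₀ : Fin n) (t : Fin 6 → Fin n) (A X mk : ℕ) (hX64 : X < 64) (hmk : c.maskOK A X mk = true) :
    {ω : BondConfig (Fin n) | tb mk (enc a₀ t ω) = true} =
      {ω : BondConfig (Fin n) | ∀ a ∈ im t A, ω ∈ (openConn a₀ a : Set (BondConfig (Fin n)))} ∩
        {ω | ∀ x ∈ im t X, ω ∉ (openConn a₀ x : Set (BondConfig (Fin n)))} := by
  unfold Cert.maskOK at hmk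
  simp only [Bool.and_eq_true, List.all_eq_true, hm] at hmk
  obtain ⟨_, hall⟩ := hmk
  ext ω
  have hK := enc_lt a₀ t ω
  have hagree : tb mk (enc a₀ t ω) = cylMem 6 A X (enc a₀ t ω) := by
    have h := hall (enc a₀ t ω) (List.mem_range.2 hK)
    cases h1 : tb mk (enc a₀ t ω) <;> cases h2 : cylMem 6 A X (enc a₀ t ω) <;> simp_all
  rw [mem_setOf_eq, hagree, cylMem_iff 6 A X _ hK]
  simp only [im, mem_inter_iff, mem_setOf_eq, forall_exists_index, and_imp]
  constructor
  · rintro ⟨hX, hA⟩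
    refine ⟨fun a x hx hxa => ?_, fun v x hx hxv => ?_⟩
    · subst hxa
      have h := hA x hx
      rw [testBit_enc] at h
      simpa using h
    · subst hxv
      have h := hX x hx
      rw [testBit_enc] at h
      simpa using h
  · rintro ⟨hatt, hcut⟩
    refine ⟨fun i hi => ?_, fun i hi => ?_⟩
    · by_cases h6 : i < 6
      · rw [testBit_enc_of_lt a₀ t ω i h6, decide_eq_true_eq]
        exact hcut (t ⟨i, h6⟩) ⟨i, h6⟩ hi rfl
      · -- `X < 64` has no bit `i ≥ 6`
        exfalso
        have hX : X < 2 ^ i := lt_of_lt_of_le (show X < 2 ^ 6 by simpa using hX64) (Nat.pow_le_pow_right (by norm_num) (by omega))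
        rw [Nat.testBit_lt_two_pow hX] at hi
        exact Bool.false_ne_true hi
    · by_cases h6 : i < 6
      · rw [testBit_enc_of_lt a₀ t ω i h6]
        have := hatt (t ⟨i, h6⟩) ⟨i, h6⟩ hi rfl
        simpa using this
      · exact testBit_enc_of_ge a₀ t ω i (by omega)

/-! ### Vanishing at the variable `64 = δ` -/

/-- The marginal forms vanish at the variable `64 = δ`. -/
theorem margMem_D (x : ℕ) : c.margMem x 64 = false := by
  unfold Cert.margMem; rw [hm]; rfl

/-- The threshold form vanishes at the variable `64 = δ`. -/
theorem tMem_D : c.tMem 64 = false := by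
  unfold Cert.tMem; rw [hm]; rfl

include hfam in
/-- The case forms vanish at the variable `64 = δ`. -/
theorem eMem_D (x : ℕ) : c.eMem x 64 = false := by
  unfold Cert.eMem Cert.margMem; rw [hfam, hm]; rfl

/-- A well-formed mask has no bit `64`. -/
theorem tb_D_of_maskOK (A X mk : ℕ) (hmk : c.maskOK A X mk = true) : tb mk 64 = false := by
  unfold Cert.maskOK at hmk
  simp only [Bool.and_eq_true, Nat.blt_eq, hm] at hmk
  rw [tb_eq]
  exact Nat.testBit_lt_two_pow hmk.1

end Dictionary

end QCert
end HubOnly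

end Summit.CriticalPhenomena.PercolationContinuityZ3.Theorems

end
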